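import Summits.ABC.IUTFork.LDHPerPrimeReading
import HarnessLib

/-!
# The fork at [IUTchIII] Corollary 3.12, L-DH level: R0 FAILS AT THE PACKET `(j, p)` of a deep bad prime

Record-only file (D-0012) of the abc-iut cell (WAVE-5 prover abc-iut-w5-d157); TAKES NO SIDE on Cor. 3.12. Sequel to
`LDHPerPrimeReading.lean` (the PER-PRIME = procession-averaged form): the same squeeze at ONE tensor degree `j = i+1` over a
prime `p` — the cell's per-PACKET reading R0 at `(j, v_ℚ = p)` (skeleton XXIV `Cor312Vol.perPlace_bound_of_pointwise`;
`HOME/skel/FORK-LOCAL-GLOBAL.md` §3 uses the top degree `j = ℓ⋆`), with the sharper factor `j² − 1` in place of `c_l − 1`: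
* `perPacket_gap_le` (any `D : DHData F`): R0 at `(j, p)` plus a Step (v)-shaped hull bound with discrepancy `δ` force
  `(j² − 1)·Q_p ≤ δ` (Dupuy–Hilado Thm. 3.10.1 per degree: `ln ν̄_{𝔸^{⊗ j+1}_p}(O_𝕃(−P_q)) = −Q_p`, `…(O_𝕃(−P_Θ)) = −j²·Q_p`);
* `lnνTensorPower_hullUTheta_le_ofIdelesM`: the per-degree Step (v) hull bound for the idele-built datum at ANY prime
  (c312-d1's `componentBound_ofIdelesM` summed over the tuples of one degree);
* `not_perPacketReading_of_deep` (GENUINE input `I`, ONE place `v₀` of `F₀` over `p`):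
  `((j+1)·d₀ + 1)·log p + (j+1)·(3 + log e₀) < (j² − 1)·P_q(v₀)·ln N(v₀)/[F₀:ℚ]` ⇒ R0 fails at the packet `(j, p)` of
  `DHData.ofInput I` — whatever the global `Cor312Of I` does.
[cite: Mochizuki2012, IUTchIV Thm. 1.10 Step (v) p. 27–28] [cite: DupuyHilado2025, §1 (1.1), Def. 3.6.3, Thm. 3.10.1]
[claim: Mochizuki2012, status: disputed] for every IUT quotation. NOT here: the verbatim `Cor312.Setting`; any judgement.
-/

noncomputable section

open Set NumberField IsDedekindDomain Literature.IUT.LogVolume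

namespace Summit.ABC.IUTFork.DHData

variable {F : Type} [Field F] [NumberField F]

/-! ## §5 Per-PACKET form at one degree `j = i+1` (sharper: factor `j² − 1` instead of `c_l − 1`) -/

section PerPacket

variable (D : DHData F)

/-- `ln ν̄_{𝔸^{⊗ j+1}_p}(O_𝕃(−P_q)) = −Q_p` in every degree. [cite: DupuyHilado2025, Thm. 3.10.1] -/
theorem lnνTensorPower_region_tq_eq (p : ℕ) [Fact p.Prime] (i : Fin D.X.lstar) :
    D.M.lnνTensorPower p ((i : ℕ) + 1) (D.M.region D.tq) =
      -FinDivisor.ndeg F (∑ v : placesOver F p, FinDivisor.of v.1 (D.X.qPilot v.1)) := by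
  rw [D.M.lnνTensorPower_region D.tq p i]
  simp_rw [D.tq_ord]

/-- `ln ν̄_{𝔸^{⊗ j+1}_p}(O_𝕃(−P_Θ)) = −j²·Q_p` in degree `j = i+1`. [cite: DupuyHilado2025, Thm. 3.10.1, §3.3] -/
theorem lnνTensorPower_region_tΘ_eq (p : ℕ) [Fact p.Prime] (i : Fin D.X.lstar) :
    D.M.lnνTensorPower p ((i : ℕ) + 1) (D.M.region D.tΘ) =
      -((((i : ℕ) + 1 : ℝ) ^ 2) * FinDivisor.ndeg F (∑ v : placesOver F p, FinDivisor.of v.1 (D.X.qPilot v.1))) := by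
  rw [D.M.lnνTensorPower_region D.tΘ p i]
  simp_rw [D.tΘ_ord]
  have hθ : ∀ v : placesOver F p, D.X.thetaPilot i v.1 = (((i : ℕ) + 1 : ℝ) ^ 2) * D.X.qPilot v.1 := by
    intro v
    rw [D.X.thetaPilot_eq_smul i, Finsupp.smul_apply, smul_eq_mul]
  simp_rw [hθ]
  rw [← smul_eq_mul (a := (((i : ℕ) + 1 : ℝ) ^ 2)), ← map_smul, Finset.smul_sum]
  congr 2
  refine Finset.sum_congr rfl fun v _ => ?_
  rw [Finsupp.smul_single, smul_eq_mul]

/-- **Per-packet squeeze at degree `j`**: R0 at the packet `(j, v_ℚ = p)` plus a Step (v)-shaped hull bound with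
discrepancy `δ` force `(j² − 1)·Q_p ≤ δ`. [cite: DupuyHilado2025, §1 (1.1), Thm. 3.10.1] [claim: Mochizuki2012, status: disputed] -/
theorem perPacket_gap_le {p : ℕ} [Fact p.Prime] (i : Fin D.X.lstar) {δ : ℝ}
    (hread : D.M.lnνTensorPower p ((i : ℕ) + 1) (D.M.region D.tq) ≤
      D.M.lnνTensorPower p ((i : ℕ) + 1) (D.M.hullUTheta D.ind3))
    (hest : D.M.lnνTensorPower p ((i : ℕ) + 1) (D.M.hullUTheta D.ind3) ≤
      D.M.lnνTensorPower p ((i : ℕ) + 1) (D.M.region D.tΘ) + δ) :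
    ((((i : ℕ) + 1 : ℝ) ^ 2) - 1) * FinDivisor.ndeg F (∑ v : placesOver F p, FinDivisor.of v.1 (D.X.qPilot v.1)) ≤ δ := by
  rw [D.lnνTensorPower_region_tq_eq p i] at hread
  rw [D.lnνTensorPower_region_tΘ_eq p i] at hest
  linarith

end PerPacket

section PerPacketIdeles

variable (X : PilotData F) (𝔽 : LocalFieldFamily F)
  (tΘ : ∀ (p : ℕ) (hp : p.Prime), Fin X.lstar → (v : placesOver F p) → (@LocalFields.k F _ _ p ⟨hp⟩ (𝔽 p hp) v)ˣ)
  (tΘ_ord : ∀ (p : ℕ) (hp : p.Prime) (i : Fin X.lstar) (v : placesOver F p),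
    @LocalFields.ordv F _ _ p ⟨hp⟩ (𝔽 p hp) v (tΘ p hp i v) = X.thetaPilot i v.1)
  (tq : ∀ (p : ℕ) (hp : p.Prime), Fin X.lstar → (v : placesOver F p) → (@LocalFields.k F _ _ p ⟨hp⟩ (𝔽 p hp) v)ˣ)
  (tq_ord : ∀ (p : ℕ) (hp : p.Prime) (i : Fin X.lstar) (v : placesOver F p),
    @LocalFields.ordv F _ _ p ⟨hp⟩ (𝔽 p hp) v (tq p hp i v) = X.qPilot v.1)
  (T : Finset ℕ) (T_prime : ∀ p ∈ T, p.Prime) (S_sub : ∀ v ∈ X.S, residueChar F v ∈ T)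

/-- **Per-packet Step (v) bound for the idele-built datum in degree `j = i+1` at ANY prime.**
[cite: Mochizuki2012, IUTchIV Thm. 1.10 Step (v) p. 27–28] -/
theorem lnνTensorPower_hullUTheta_le_ofIdelesM {p : ℕ} [hp : Fact p.Prime] (i : Fin X.lstar) :
    (ofIdelesM X 𝔽 tΘ tΘ_ord tq tq_ord T T_prime S_sub).M.lnνTensorPower p ((i : ℕ) + 1)
        ((ofIdelesM X 𝔽 tΘ tΘ_ord tq tq_ord T T_prime S_sub).M.hullUTheta
          (ofIdelesM X 𝔽 tΘ tΘ_ord tq tq_ord T T_prime S_sub).ind3) ≤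
      (ofIdelesM X 𝔽 tΘ tΘ_ord tq tq_ord T T_prime S_sub).M.lnνTensorPower p ((i : ℕ) + 1)
          ((ofIdelesM X 𝔽 tΘ tΘ_ord tq tq_ord T T_prime S_sub).M.region
            (ofIdelesM X 𝔽 tΘ tΘ_ord tq tq_ord T T_prime S_sub).tΘ) +
        ∑ e : Fin ((i : ℕ) + 1 + 1) → placesOver F p, stepVDelta X 𝔽 p ((i : ℕ) + 1) e * ∏ k, weight F (e k).1 := by
  refine (ofIdelesM X 𝔽 tΘ tΘ_ord tq tq_ord T T_prime S_sub).M.lnνTensorPower_le_add_sum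
    (stepVDelta X 𝔽 p ((i : ℕ) + 1)) ?_
  intro e
  have hc : p.Prime ∧ 0 < (i : ℕ) + 1 ∧ (i : ℕ) + 1 - 1 < X.lstar := ⟨hp.out, Nat.succ_pos _, by simp [i.2]⟩
  rw [stepVDelta, dif_pos hc]
  obtain ⟨i₀, -, hi₀⟩ := Finset.exists_min_image Finset.univ
    (fun a : Fin ((i : ℕ) + 1 + 1) =>
      X.thetaPilot ⟨(i : ℕ) + 1 - 1, hc.2.2⟩ (e a).1 * logNorm F (e a).1 / localDegree F (e a).1)
    ⟨0, Finset.mem_univ _⟩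
  have hcb := componentBound_ofIdelesM X 𝔽 tΘ tΘ_ord tq tq_ord T T_prime S_sub (j := (i : ℕ) + 1)
    (Nat.succ_pos _) (by have := i.2; omega) e
    (Finset.univ.filter (fun a => p - 2 < absRamificationIdx p ((𝔽 p hp.out).k (e a))))
    (fun a ha => by
      rw [Finset.mem_filter, not_and] at ha
      exact Nat.le_of_not_lt (ha (Finset.mem_univ a)))
    i₀ (fun a => hi₀ a (Finset.mem_univ a))
  have hinf : Finset.univ.inf' ⟨0, Finset.mem_univ _⟩ (fun a : Fin ((i : ℕ) + 1 + 1) =>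
      X.thetaPilot ⟨(i : ℕ) + 1 - 1, hc.2.2⟩ (e a).1 * logNorm F (e a).1 / localDegree F (e a).1) ≤
      X.thetaPilot ⟨(i : ℕ) + 1 - 1, hc.2.2⟩ (e i₀).1 * logNorm F (e i₀).1 / localDegree F (e i₀).1 :=
    Finset.inf'_le _ (Finset.mem_univ i₀)
  linarith

end PerPacketIdeles

section PerPacketGenuine

variable {K : Type} [Field K] [NumberField K] [Algebra F K] (I : ThetaVolumeInput F K)

/-- **R0 FAILS AT THE PACKET `(j, p)` OF A DEEP BAD PRIME** (ONE place `v₀` of `F₀` over `p`, degree `j = i+1`):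
`((j+1)·d₀ + 1)·log p + (j+1)·(3 + log e₀) < (j² − 1)·P_q(v₀)·ln N(v₀)/[F₀:ℚ]` gives
`¬ (ln ν̄_{𝔸^{⊗ j+1}_p}(O_𝕃(−P_q)) ≤ ln ν̄_{𝔸^{⊗ j+1}_p}(hull(U_Θ)))` for the datum of the GENUINE input `I` — the top degree
`j = ℓ⋆` is skeleton §3's instance (factor `ℓ⋆² − 1`). [cite: Mochizuki2012, IUTchIV Thm. 1.10 Step (v) p. 27–28]
[cite: DupuyHilado2025, §1 (1.1), Thm. 3.10.1] [claim: Mochizuki2012, status: disputed] -/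
theorem not_perPacketReading_of_deep {p : ℕ} [hpi : Fact p.Prime] (hp1 : ∀ v w : placesOver F p, v = w)
    (v₀ : placesOver F p) (i : Fin I.X.lstar)
    (hdeep : ((((i : ℕ) : ℝ) + 2) * differentOrd p ((I.σ.localFieldFamily p hpi.out).k v₀) + 1) * Real.log p
        + (((i : ℕ) : ℝ) + 2) * (3 + Real.log (absRamificationIdx p ((I.σ.localFieldFamily p hpi.out).k v₀))) <
      ((((i : ℕ) + 1 : ℝ) ^ 2) - 1) * (I.X.qPilot v₀.1 * logNorm F v₀.1 / Module.finrank ℚ F)) :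
    ¬ (ofInput I).M.lnνTensorPower p ((i : ℕ) + 1) ((ofInput I).M.region (ofInput I).tq) ≤
      (ofInput I).M.lnνTensorPower p ((i : ℕ) + 1) ((ofInput I).M.hullUTheta (ofInput I).ind3) := by
  intro hread
  have hest := lnνTensorPower_hullUTheta_le_ofIdelesM I.X I.σ.localFieldFamily I.tΘ I.tΘ_ord I.tq I.tq_ord
    I.supportPrimes (fun _ hp => I.prime_of_mem_supportPrimes hp) (fun _ hv => I.residueChar_mem_supportPrimes hv)
    (p := p) i
  have hgap := (ofInput I).perPacket_gap_le i hread hest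
  have hδ := stepVDelta_sum_le_of_subsingleton I.X I.σ.localFieldFamily hp1 v₀ i
  rw [show FinDivisor.ndeg F (∑ v : placesOver F p, FinDivisor.of v.1 ((ofInput I).X.qPilot v.1)) =
    I.X.qPilot v₀.1 * logNorm F v₀.1 / Module.finrank ℚ F from localQMass_eq_of_subsingleton I hp1 v₀] at hgap
  linarith

end PerPacketGenuine

end Summit.ABC.IUTFork.DHData

end
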